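import Summits.QuantumFields.YangMills.Theses.SqueezedSkewness
import Summits.QuantumFields.YangMills.Theorems.SqueezedSkewnessTorusFloorsGlue
import Summits.QuantumFields.YangMills.Theorems.SqueezedSkewnessKLCoherence
import Summits.QuantumFields.YangMills.Theorems.SqueezedSkewnessDivisibleBump

/-!
# Birth skeleton — LINE α «torus-direct Källén–Lehmann» REGISTERED ON THE NODE `PointlikeHypercubeFloors`
# (stmt-QuantumFields-23205; planner ym-idea-6 g12)

From rev 18 on, the every-radius hypercube floor `SqueezedSkewness.PointlikeHypercubeFloors` is the clause-(i) BINDER of the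
route's deciding theorem, and its decompositions are LINES registered on that item.  THIS file registers LINE α (planner g10,
unchanged content): the three OPEN items `LowPassFloorH` (23201), `AntipodalMirrorCeiling` (23202 — split into `FloorUnitFBL6`
23389 + `AntipodalMixing` 23390 + glue 23391, provers active) and `TorusKL` (23204) BY NAME, composed through the LANDED support
items `TorusFloorsGlue ✓` (`torusFloorsGlue_proof`), `KLCoherence ✓` (`klCoherence_proof`) and `DivisibleBump ✓` (`divisibleBump_proof`).
The sibling LINE χ «chord escalator» is `Lines/pointlike_chord_birth.lean`.  Sorries: exactly the three stubs.  No NT / summit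
statement is proved here. [folklore]
-/

set_option autoImplicit false

namespace Summit.QuantumFields.YangMills.Cruxes.NT.PointlikeLowPassBirth

open Summit.QuantumFields.YangMills.Theses.SqueezedSkewness

namespace __Registered

/-- = `SqueezedSkewness.LowPassFloorH` (stmt-QuantumFields-23201, crux r2) BY NAME. -/
abbrev stub_lowPassFloorH : Prop :=
  Summit.QuantumFields.YangMills.Theses.SqueezedSkewness.LowPassFloorH

/-- = `SqueezedSkewness.AntipodalMirrorCeiling` (stmt-QuantumFields-23202, crux r3; split 23389/23390/23391) BY NAME. -/
abbrev stub_antipodalMirrorCeiling : Prop :=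
  Summit.QuantumFields.YangMills.Theses.SqueezedSkewness.AntipodalMirrorCeiling

/-- = `SqueezedSkewness.TorusKL` (stmt-QuantumFields-23204, crux r5) BY NAME. -/
abbrev stub_torusKL : Prop :=
  Summit.QuantumFields.YangMills.Theses.SqueezedSkewness.TorusKL

end __Registered

/-- stub (crux, XL; item 23201): the zero-momentum low-pass floor with period `2L+1`. OPEN. -/
theorem stub_lowPassFloorH : __Registered.stub_lowPassFloorH := by
  sorry

/-- stub (crux, L/XL; item 23202, split → 23389 FloorUnitFBL6 + 23390 AntipodalMixing + 23391 glue): the antipodal mirror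
ceiling — the ONE infrared payment of LINE α. OPEN (provers active). -/
theorem stub_antipodalMirrorCeiling : __Registered.stub_antipodalMirrorCeiling := by
  sorry

/-- stub (crux, L−; item 23204; `stub_mixedParseval` landed p663295/p662225, `stub_torusMixtureData` open): the torus
Källén–Lehmann representation of `Qrp`. OPEN. -/
theorem stub_torusKL : __Registered.stub_torusKL := by
  sorry

/-- **Composition (kernel-checked, no sorry of its own):** LINE α closes the node `PointlikeHypercubeFloors` through the landed
`TorusFloorsGlue`, `KLCoherence`, `DivisibleBump`. -/
theorem PointlikeHypercubeFloors_of (h1 : __Registered.stub_lowPassFloorH)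
    (h2 : __Registered.stub_antipodalMirrorCeiling) (h3 : __Registered.stub_torusKL) :
    Summit.QuantumFields.YangMills.Theses.SqueezedSkewness.PointlikeHypercubeFloors :=
  Summit.QuantumFields.YangMills.Theorems.SqueezedSkewnessTorusFloorsGlue.torusFloorsGlue_proof h1
    Summit.QuantumFields.YangMills.Theorems.KLCoherence.klCoherence_proof h3 h2
    Summit.QuantumFields.YangMills.Theorems.SqueezedSkewnessDivisibleBump.divisibleBump_proof

end Summit.QuantumFields.YangMills.Cruxes.NT.PointlikeLowPassBirth
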